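import Literature.Topology.FourManifolds.SweepCapping
import Literature.Topology.FourManifolds.SweepLemma
import Literature.Topology.FourManifolds.CollarFill
import Literature.Topology.FourManifolds.SideComparison
import HarnessLib

/-!
# Transferring a sweep from a sub-solid (Schultens' Schönflies proof, the gluing step)

Topic `Literature/Topology/FourManifolds`.  In the inductive step of the Morse-theoretic proof of
the smooth Schönflies theorem (Schultens, *Introduction to 3-Manifolds* (2014), Thm. 3.2.5,
PDF p. 45; the classical "ball glued to a ball along a disc is a ball"), a compact regular solid
`A₁ = {F₁ ≤ 0}` contains the sub-solid `B = {F_B ≤ 0}`, and the induction hypothesis supplies a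
smooth function `w` sweeping `B`: no critical points on `B ∩ {w ≤ 1 + 3δ₀}` and, at the boundary
points of `B` with `w ≤ 1 + 3δ₀` outside an explicit region `G`, the gradient of `w` is never an
outward conormal of `B`.  Where `∂B` and `∂A₁` agree (outside `G`) the conormals are positively
proportional, and on `G` everything is explicit.  `exists_sweep` caps `w` off
(`SweepCapping.exists_capping_off`), verifies the hypotheses of the sweep lemma
(`SmoothMax.exists_diffeomorph_image_sweep`) for `A₁` by one compactness argument, and returns the
sweeping diffeomorphism.

## References
* J. Schultens, *Introduction to 3-Manifolds*, GSM 151, AMS (2014), Thm. 3.2.5, Lemma 3.2.3.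
* M. W. Hirsch, *Differential Topology*, Springer GTM 33 (1976), §8.3.
-/

noncomputable section

open Set Metric Filter Topology
open scoped Manifold ContDiff

namespace Literature.Topology.FourManifolds.SweepTransfer

variable {E : Type*} [NormedAddCommGroup E] [InnerProductSpace ℝ E] [FiniteDimensional ℝ E]

omit [FiniteDimensional ℝ E] in
/-- A zero of `F₁` with nonzero derivative is not an interior point of `{F₁ ≤ 0}`; hence a point
of `B ⊆ A₁ = {F₁ ≤ 0}` on the regular boundary `{F₁ = 0}` lies on `{F_B = 0}`. [folklore] -/
theorem eq_zero_of_mem_of_zero {F₁ FB : E → ℝ} (hFB : Continuous FB)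
    (hsub : ∀ x, FB x ≤ 0 → F₁ x ≤ 0) {x : E} (hreg : fderiv ℝ F₁ x ≠ 0) (h0 : F₁ x = 0)
    (hx : FB x ≤ 0) : FB x = 0 := by
  rcases hx.lt_or_eq with hlt | heq
  · exfalso
    apply hreg
    apply IsLocalMax.fderiv_eq_zero
    have hn : {y | FB y < 0} ∈ 𝓝 x := (isOpen_lt hFB continuous_const).mem_nhds hlt
    filter_upwards [hn] with y hy
    rw [h0]
    exact hsub y (le_of_lt hy)
  · exact heq

/-! ### §0 Shared boundary: positive proportionality and local agreement -/

/-- A function vanishing at `0` with negative derivative there is negative just to the right.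
[folklore] -/
theorem eventually_neg_of_hasDerivAt {g : ℝ → ℝ} {g' : ℝ} (hg : HasDerivAt g g' 0) (h0 : g 0 = 0)
    (hneg : g' < 0) : ∀ᶠ t in 𝓝[>] (0 : ℝ), g t < 0 := by
  have htend := hg.tendsto_slope_zero
  have hev : ∀ᶠ t in 𝓝[≠] (0 : ℝ), t⁻¹ • (g (0 + t) - g 0) < 0 := htend (Iio_mem_nhds hneg)
  have hev' : ∀ᶠ t in 𝓝[>] (0 : ℝ), t⁻¹ • (g (0 + t) - g 0) < 0 :=
    hev.filter_mono (nhdsWithin_mono _ fun t ht => ne_of_gt ht)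
  filter_upwards [hev', self_mem_nhdsWithin] with t hslope ht
  rw [h0, sub_zero, zero_add, smul_eq_mul] at hslope
  rcases mul_neg_iff.1 hslope with ⟨-, h2⟩ | ⟨h1, -⟩
  · exact h2
  · exact absurd (inv_pos.2 (mem_Ioi.1 ht)) (not_lt.2 h1.le)

/-- A function vanishing at `0` with positive derivative there is positive just to the right.
[folklore] -/
theorem eventually_pos_of_hasDerivAt {g : ℝ → ℝ} {g' : ℝ} (hg : HasDerivAt g g' 0) (h0 : g 0 = 0)
    (hpos : 0 < g') : ∀ᶠ t in 𝓝[>] (0 : ℝ), 0 < g t := by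
  have h := eventually_neg_of_hasDerivAt hg.neg (by simp [h0]) (neg_neg_of_pos hpos)
  filter_upwards [h] with t ht
  simpa using ht

omit [FiniteDimensional ℝ E] in
/-- **The proportionality factor of nested solids is positive.**  If `B = {F_B ≤ 0} ⊆ A₁ = {F₁ ≤ 0}`,
both functions vanish at `b` with `DF₁(b) = μ DF_B(b)`, `DF_B(b) ≠ 0`, then `μ ≥ 0`; hence
`μ > 0` when `μ ≠ 0`. [folklore] -/
theorem pos_of_subset {F₁ FB : E → ℝ} (hF₁ : Differentiable ℝ F₁) (hFB : Differentiable ℝ FB)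
    (hsub : ∀ x, FB x ≤ 0 → F₁ x ≤ 0) {b : E} (h₁ : F₁ b = 0) (hB : FB b = 0)
    (hDB : fderiv ℝ FB b ≠ 0) {μ : ℝ} (hμ : μ ≠ 0) (hprop : fderiv ℝ F₁ b = μ • fderiv ℝ FB b) :
    0 < μ := by
  rcases lt_or_gt_of_ne hμ with hneg | hpos
  swap; · exact hpos
  exfalso
  -- a direction `v` with `DF_B(b) v > 0`
  obtain ⟨u, hu⟩ : ∃ u, fderiv ℝ FB b u ≠ 0 := by
    by_contra hall; push Not at hall; exact hDB (ContinuousLinearMap.ext hall)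
  obtain ⟨v, hv⟩ : ∃ v, 0 < fderiv ℝ FB b v := by
    rcases lt_or_gt_of_ne hu with hl | hl
    · exact ⟨-u, by rw [map_neg]; linarith⟩
    · exact ⟨u, hl⟩
  -- along `t ↦ b - t v`: `F_B` becomes negative, `F₁` becomes positive
  have hline : HasDerivAt (fun t : ℝ => b + t • (-v)) (-v) 0 := by
    simpa using ((hasDerivAt_id (0 : ℝ)).smul_const (-v)).const_add b
  have hb0 : b + (0 : ℝ) • (-v) = b := by simp
  have hgB : HasDerivAt (fun t : ℝ => FB (b + t • (-v))) (fderiv ℝ FB b (-v)) 0 := by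
    have h : HasFDerivAt FB (fderiv ℝ FB b) (b + (0 : ℝ) • (-v)) := by
      rw [hb0]; exact (hFB b).hasFDerivAt
    exact h.comp_hasDerivAt 0 hline
  have hg₁ : HasDerivAt (fun t : ℝ => F₁ (b + t • (-v))) (fderiv ℝ F₁ b (-v)) 0 := by
    have h : HasFDerivAt F₁ (fderiv ℝ F₁ b) (b + (0 : ℝ) • (-v)) := by
      rw [hb0]; exact (hF₁ b).hasFDerivAt
    exact h.comp_hasDerivAt 0 hline
  have hB' : fderiv ℝ FB b (-v) < 0 := by rw [map_neg]; linarith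
  have h₁' : 0 < fderiv ℝ F₁ b (-v) := by
    rw [hprop, _root_.smul_apply, map_neg, smul_eq_mul]; nlinarith
  have hevB := eventually_neg_of_hasDerivAt hgB (by simpa using hB) hB'
  have hev₁ := eventually_pos_of_hasDerivAt hg₁ (by simpa using h₁) h₁'
  obtain ⟨t, htB, ht₁⟩ := (hevB.and hev₁).exists
  have := hsub _ htB.le
  linarith

/-- **Two regular functions vanishing on the same embedded germ have proportional differentials**
(local version of `SideComparison.exists_fderiv_eq_smul`: `F ∘ f` and `G ∘ f` vanish near `x`).
[folklore] -/
theorem exists_ne_zero_smul_local {m : ℕ} {M : Type*} [TopologicalSpace M]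
    [ChartedSpace (EuclideanSpace ℝ (Fin m)) M] [IsManifold (𝓡 m) ∞ M]
    (hdim : Module.finrank ℝ E = m + 1) {f : M → E} {x : M}
    (hf : MDifferentiableAt (𝓡 m) 𝓘(ℝ, E) f x)
    (hinj : Function.Injective (mfderiv (𝓡 m) 𝓘(ℝ, E) f x)) {F G : E → ℝ}
    (hF : DifferentiableAt ℝ F (f x)) (hFf : ∀ᶠ y in 𝓝 x, F (f y) = 0) (hDF : fderiv ℝ F (f x) ≠ 0)
    (hG : DifferentiableAt ℝ G (f x)) (hGf : ∀ᶠ y in 𝓝 x, G (f y) = 0) (hDG : fderiv ℝ G (f x) ≠ 0) :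
    ∃ μ : ℝ, μ ≠ 0 ∧ fderiv ℝ F (f x) = μ • fderiv ℝ G (f x) := by
  set L : EuclideanSpace ℝ (Fin m) →L[ℝ] E := mfderiv (𝓡 m) 𝓘(ℝ, E) f x with hL
  -- the image of `df_x` lies in both kernels and has dimension `m`
  have hker : ∀ (H : E → ℝ), DifferentiableAt ℝ H (f x) → (∀ᶠ y in 𝓝 x, H (f y) = 0) →
      ∀ a, fderiv ℝ H (f x) (L a) = 0 := by
    intro H hH hHf a
    have h1 : mfderiv (𝓡 m) 𝓘(ℝ, ℝ) (H ∘ f) x =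
        (mfderiv 𝓘(ℝ, E) 𝓘(ℝ, ℝ) H (f x)).comp (mfderiv (𝓡 m) 𝓘(ℝ, E) f x) :=
      mfderiv_comp x hH.mdifferentiableAt hf
    rw [mfderiv_eq_fderiv] at h1
    have h2 : mfderiv (𝓡 m) 𝓘(ℝ, ℝ) (H ∘ f) x = 0 := by
      have heq : (H ∘ f) =ᶠ[𝓝 x] fun _ => (0 : ℝ) := hHf
      rw [heq.mfderiv_eq, mfderiv_const]; rfl
    rw [h2] at h1
    have := congrArg (fun T : TangentSpace (𝓡 m) x →L[ℝ] ℝ => T a) h1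
    exact this.symm
  set RL : Submodule ℝ E := LinearMap.range L.toLinearMap with hRL
  have hr : Module.finrank ℝ RL = m := by
    have h1 := LinearMap.finrank_range_of_inj (f := (L : EuclideanSpace ℝ (Fin m) →ₗ[ℝ] E)) hinj
    rw [hRL, h1]
    exact finrank_euclideanSpace_fin
  -- both kernels equal `RL`
  have hkerEq : ∀ (H : E → ℝ), DifferentiableAt ℝ H (f x) → (∀ᶠ y in 𝓝 x, H (f y) = 0) →
      fderiv ℝ H (f x) ≠ 0 → LinearMap.ker (fderiv ℝ H (f x)).toLinearMap = RL := by
    intro H hH hHf hDH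
    set K : Submodule ℝ E := LinearMap.ker (fderiv ℝ H (f x)).toLinearMap with hK
    have hle : RL ≤ K := by
      rintro w ⟨a, rfl⟩
      exact hker H hH hHf a
    have hk : Module.finrank ℝ K < m + 1 := by
      rw [← hdim]
      refine Submodule.finrank_lt fun htop => hDH ?_
      ext w
      have hw : w ∈ K := by rw [htop]; trivial
      exact hw
    exact (Submodule.eq_of_le_of_finrank_le hle (by omega)).symm
  have hKF := hkerEq F hF hFf hDF
  have hKG := hkerEq G hG hGf hDG
  have hsub : ∀ w, fderiv ℝ G (f x) w = 0 → fderiv ℝ F (f x) w = 0 := by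
    intro w hw
    have hw' : w ∈ LinearMap.ker (fderiv ℝ G (f x)).toLinearMap := hw
    rw [hKG, ← hKF] at hw'
    exact hw'
  obtain ⟨μ, hμ⟩ := ExpHeight.exists_eq_smul_of_forall_eq_zero hDG hsub
  refine ⟨μ, fun h0 => hDF ?_, hμ⟩
  rw [hμ, h0, zero_smul]

/-- **Local agreement of nested solids with a common boundary germ.**  Let
`B = {F_B ≤ 0} ⊆ A₁ = {F₁ ≤ 0}` (`C¹` functions), `f : M → E` a local parametrisation of the
hypersurface through `b = f x` with `F₁ ∘ f = 0` and `F_B ∘ f = 0` near `x`, both differentials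
nonzero at `b`, and assume the zero sets of `F₁`, `F_B` agree near `b`.  Then
`DF₁(b) = μ DF_B(b)` with `μ > 0`, and `A₁`, `B` agree near `b`.
[cite: Schultens2014, proof of Thm. 3.2.5 (PDF p. 45)] -/
theorem agree_of_zeroSet {m : ℕ} {M : Type*} [TopologicalSpace M]
    [ChartedSpace (EuclideanSpace ℝ (Fin m)) M] [IsManifold (𝓡 m) ∞ M]
    (hdim : Module.finrank ℝ E = m + 1) {f : M → E} {x : M}
    (hf : MDifferentiableAt (𝓡 m) 𝓘(ℝ, E) f x)
    (hinj : Function.Injective (mfderiv (𝓡 m) 𝓘(ℝ, E) f x)) {F₁ FB : E → ℝ}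
    (hF₁ : ContDiff ℝ 1 F₁) (hFB : ContDiff ℝ 1 FB) (hsub : ∀ y, FB y ≤ 0 → F₁ y ≤ 0)
    (h₁f : ∀ᶠ y in 𝓝 x, F₁ (f y) = 0) (hBf : ∀ᶠ y in 𝓝 x, FB (f y) = 0)
    (hD₁ : fderiv ℝ F₁ (f x) ≠ 0) (hDB : fderiv ℝ FB (f x) ≠ 0)
    (hZ : ∀ᶠ y in 𝓝 (f x), F₁ y = 0 ↔ FB y = 0) :
    (∃ μ : ℝ, 0 < μ ∧ fderiv ℝ F₁ (f x) = μ • fderiv ℝ FB (f x)) ∧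
      ∀ᶠ y in 𝓝 (f x), (F₁ y ≤ 0 ↔ FB y ≤ 0) := by
  have hF₁d : Differentiable ℝ F₁ := hF₁.differentiable (by norm_num)
  have hFBd : Differentiable ℝ FB := hFB.differentiable (by norm_num)
  have h₁0 : F₁ (f x) = 0 := h₁f.self_of_nhds
  have hB0 : FB (f x) = 0 := hBf.self_of_nhds
  obtain ⟨μ, hμ0, hprop⟩ := exists_ne_zero_smul_local hdim hf hinj (hF₁d _) h₁f hD₁ (hFBd _)
    hBf hDB
  have hμ : 0 < μ := pos_of_subset hF₁d hFBd hsub h₁0 hB0 hDB hμ0 hprop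
  refine ⟨⟨μ, hμ, hprop⟩, ?_⟩
  have hsign := SideComparison.eventually_sign_iff hF₁ hFB hB0 hZ hDB hμ hprop
  filter_upwards [hsign] with y hy
  constructor
  · intro h; by_contra hc; exact absurd (hy.2.2 (not_le.1 hc)) (not_lt.2 h)
  · intro h; by_contra hc; exact absurd (hy.2.1 (not_le.1 hc)) (not_lt.2 h)

/-- **Transfer of a sweep.**  Let `A₁ = {F₁ ≤ 0}` be a compact regular smooth solid containing
`B = {F_B ≤ 0}` (`F_B` smooth), `w` smooth, `G` open, `δ₀ > 0`, `Z` closed and disjoint from `B`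
and `closure G`, `W ≥ 1 + 6δ₀`.  Assume: local agreement of `A₁` and `B` near the boundary points
of `B` with `w ≤ 1 + 3δ₀` outside `G` and the frontier condition for `G` (as in
`SweepCapping.exists_capping_off`); no critical points of `w` on `B ∩ {w ≤ 1 + 3δ₀}` and on
`G ∩ A₁ ∩ {w ≤ 1 + 3δ₀}`; at boundary points of `B` outside `G` with `w ≤ 1 + 3δ₀` the derivative
of `w` is not a nonnegative multiple of that of `F_B`, and where moreover `F₁ = 0` the derivatives
of `F₁` and `F_B` are positively proportional; at boundary points of `A₁` in `G` with
`w ≤ 1 + 3δ₀` the derivative of `w` is not a nonnegative multiple of that of `F₁`.  Then there are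
a smooth `w̃`, agreeing with `w` on an open set containing `B` and `G ∩ {w < 1 + 4δ₀}` and equal
to `W` on `Z`, a `δ ∈ (0, δ₀]`, and a diffeomorphism `Φ` of `E` with
`Φ(A₁) = {F₁ ⊔_δ (1 - w̃) ≤ 0}`, `Φ({F₁ = 0}) = {F₁ ⊔_δ (1 - w̃) = 0}`, `Φ = id` where
`w̃ + F₁ ≥ 1 + δ`. [cite: Schultens2014, proof of Thm. 3.2.5 (PDF p. 45)] -/
theorem exists_sweep {P : ℝ → ℝ} (hP : ContDiff ℝ ∞ P)
    (hP0 : ∀ s, s ≤ -1 → P s = 0) (hP1 : ∀ s, 1 ≤ s → P s = s)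
    (hPd : ∀ s, 0 ≤ deriv P s ∧ deriv P s ≤ 1) (hPge : ∀ s, max 0 s ≤ P s)
    (hPle : ∀ s, P s ≤ max 0 s + 1)
    {F₁ FB w : E → ℝ} (hF₁ : ContDiff ℝ ∞ F₁) (hFB : ContDiff ℝ ∞ FB) (hw : ContDiff ℝ ∞ w)
    {ε₁ : ℝ} (hε₁ : 0 < ε₁) (hK₁ : IsCompact {x | F₁ x ≤ ε₁})
    (hreg₁ : ∀ x, F₁ x = 0 → fderiv ℝ F₁ x ≠ 0) (hsub : ∀ x, FB x ≤ 0 → F₁ x ≤ 0)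
    {G : Set E} (hG : IsOpen G) {δ₀ : ℝ} (hδ₀ : 0 < δ₀)
    (Hagree : ∀ b, FB b = 0 → w b ≤ 1 + 3 * δ₀ → b ∉ G → ∀ᶠ y in 𝓝 b, (F₁ y ≤ 0 ↔ FB y ≤ 0))
    (Hbdry : ∀ x ∈ frontier G, F₁ x ≤ 0 → w x ≤ 1 + 4 * δ₀ → FB x ≤ 0)
    (HB2 : ∀ x, FB x ≤ 0 → w x ≤ 1 + 3 * δ₀ → fderiv ℝ w x ≠ 0)
    (HG2 : ∀ x ∈ G, F₁ x ≤ 0 → w x ≤ 1 + 3 * δ₀ → fderiv ℝ w x ≠ 0)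
    (HB3 : ∀ x, FB x = 0 → x ∉ G → w x ≤ 1 + 3 * δ₀ → ∀ c : ℝ, 0 ≤ c →
      fderiv ℝ w x ≠ c • fderiv ℝ FB x)
    (Hprop : ∀ x, FB x = 0 → F₁ x = 0 → x ∉ G → w x ≤ 1 + 3 * δ₀ →
      ∃ μ : ℝ, 0 < μ ∧ fderiv ℝ F₁ x = μ • fderiv ℝ FB x)
    (HG3 : ∀ x ∈ G, F₁ x = 0 → w x ≤ 1 + 3 * δ₀ → ∀ c : ℝ, 0 ≤ c →
      fderiv ℝ w x ≠ c • fderiv ℝ F₁ x)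
    {W : ℝ} (hW : 1 + 6 * δ₀ ≤ W) {Z : Set E} (hZ : IsClosed Z) (hZB : Disjoint Z {x | FB x ≤ 0})
    (hZG : Disjoint Z (closure G)) :
    ∃ (wt : E → ℝ) (T : Set E) (δ : ℝ) (Φ : E ≃ₘ⟮𝓘(ℝ, E), 𝓘(ℝ, E)⟯ E),
      ContDiff ℝ ∞ wt ∧ IsOpen T ∧ {x | FB x ≤ 0} ⊆ T ∧ G ∩ {x | w x < 1 + 4 * δ₀} ⊆ T ∧
      (∀ x ∈ T, wt x = w x) ∧ (∀ x ∈ Z, wt x = W) ∧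
      (∀ x, F₁ x ≤ 0 → wt x ≤ 1 + 3 * δ₀ → x ∈ T ∧ (FB x ≤ 0 ∨ x ∈ G)) ∧
      0 < δ ∧ δ ≤ δ₀ ∧
      Φ '' {x | F₁ x ≤ 0} = {x | F₁ x + δ * P ((1 - wt x - F₁ x) / δ) ≤ 0} ∧
      Φ '' {x | F₁ x = 0} = {x | F₁ x + δ * P ((1 - wt x - F₁ x) / δ) = 0} ∧
      (∀ x, 1 + δ ≤ wt x + F₁ x → Φ x = x) ∧
      (∀ x, F₁ x + δ * P ((1 - wt x - F₁ x) / δ) = 0 →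
        fderiv ℝ (fun y => F₁ y + δ * P ((1 - wt y - F₁ y) / δ)) x ≠ 0) ∧
      (∀ x, F₁ x + δ * P ((1 - wt x - F₁ x) / δ) ≤ 0 → F₁ x ≤ 0 ∧ 1 ≤ wt x) ∧
      (∀ x, 1 + δ ≤ wt x + F₁ x → F₁ x + δ * P ((1 - wt x - F₁ x) / δ) = F₁ x) ∧
      (∀ x, F₁ x + wt x ≤ 1 - δ → F₁ x + δ * P ((1 - wt x - F₁ x) / δ) = 1 - wt x) := by
  have hF₁c : Continuous F₁ := hF₁.continuous
  have hFBc : Continuous FB := hFB.continuous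
  have hwc : Continuous w := hw.continuous
  have hcptB : IsCompact {x | FB x ≤ 0} :=
    hK₁.of_isClosed_subset (isClosed_le hFBc continuous_const)
      fun x hx => le_trans (hsub x hx) hε₁.le
  have hA₁c : IsCompact {x | F₁ x ≤ 0} :=
    hK₁.of_isClosed_subset (isClosed_le hF₁c continuous_const) fun x hx => le_trans hx hε₁.le
  obtain ⟨ζ, T, hζs, hζ01, hTo, hBT, hζ1, hTBG, hsmall, hGT, hζZ⟩ :=
    SweepCapping.exists_capping_off hF₁c hFBc hwc hcptB hG hδ₀ Hagree Hbdry hW hZ hZB hZG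
  -- the capped function
  set wt : E → ℝ := fun x => ζ x * w x + (1 - ζ x) * W with hwt_def
  have hwts : ContDiff ℝ ∞ wt := (hζs.mul hw).add ((contDiff_const.sub hζs).mul contDiff_const)
  have hwtT : ∀ x ∈ T, wt x = w x := by
    intro x hx
    simp only [hwt_def, hζ1 x hx]
    ring
  have hwtZ : ∀ x ∈ Z, wt x = W := by
    intro x hx
    simp only [hwt_def, hζZ x hx]
    ring
  -- `wt = w` near points of `T`, hence equal derivatives there
  have hDwt : ∀ x ∈ T, fderiv ℝ wt x = fderiv ℝ w x := by
    intro x hx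
    apply Filter.EventuallyEq.fderiv_eq
    filter_upwards [hTo.mem_nhds hx] with y hy using hwtT y hy
  -- constrained points of `A₁`
  have hcon : ∀ x, F₁ x ≤ 0 → wt x ≤ 1 + 3 * δ₀ → x ∈ T ∧ (FB x ≤ 0 ∨ x ∈ G) := by
    intro x hF hv
    have hxT : x ∈ T := hsmall x hF hv
    refine ⟨hxT, hTBG x hxT hF ?_⟩
    rw [← hwtT x hxT]
    exact hv
  -- H2 on all of `A₁ ∩ {wt ≤ 1 + 3δ₀}`
  have H2' : ∀ x, F₁ x ≤ 0 → wt x ≤ 1 + 3 * δ₀ → fderiv ℝ wt x ≠ 0 := by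
    intro x hF hv
    obtain ⟨hxT, hBG⟩ := hcon x hF hv
    have hwx : w x ≤ 1 + 3 * δ₀ := by rw [← hwtT x hxT]; exact hv
    rw [hDwt x hxT]
    rcases hBG with hb | hg
    · exact HB2 x hb hwx
    · exact HG2 x hg hF hwx
  -- H3 at boundary points (`c > 0`)
  have H3' : ∀ x, F₁ x = 0 → wt x ≤ 1 + 3 * δ₀ → ∀ c : ℝ, 0 < c →
      fderiv ℝ wt x ≠ c • fderiv ℝ F₁ x := by
    intro x h0 hv c hc heq
    obtain ⟨hxT, hBG⟩ := hcon x h0.le hv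
    have hwx : w x ≤ 1 + 3 * δ₀ := by rw [← hwtT x hxT]; exact hv
    rw [hDwt x hxT] at heq
    by_cases hg : x ∈ G
    · exact HG3 x hg h0 hwx c hc.le heq
    · rcases hBG with hb | hg'
      · have hb0 : FB x = 0 := eq_zero_of_mem_of_zero hFBc hsub (hreg₁ x h0) h0 hb
        obtain ⟨μ, hμ, hprop⟩ := Hprop x hb0 h0 hg hwx
        apply HB3 x hb0 hg hwx (c * μ) (mul_pos hc hμ).le
        rw [heq, hprop, smul_smul]
      · exact absurd hg' hg
  -- the closed bad set `C`
  set C : Set E := {x | F₁ x ≤ 0 ∧ wt x ≤ 1 + 3 * δ₀ ∧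
    ‖fderiv ℝ F₁ x‖ • fderiv ℝ wt x = ‖fderiv ℝ wt x‖ • fderiv ℝ F₁ x} with hC_def
  have hDF₁c : Continuous fun x => fderiv ℝ F₁ x := hF₁.continuous_fderiv (by simp)
  have hDwtc : Continuous fun x => fderiv ℝ wt x := hwts.continuous_fderiv (by simp)
  have hCcl : IsClosed C := by
    refine (isClosed_le hF₁c continuous_const).inter
      ((isClosed_le hwts.continuous continuous_const).inter (isClosed_eq ?_ ?_))
    · exact hDF₁c.norm.smul hDwtc
    · exact hDwtc.norm.smul hDF₁c
  have hCc : IsCompact C := hA₁c.of_isClosed_subset hCcl fun x hx => hx.1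
  -- `C` misses `{F₁ = 0}`
  have hC0 : ∀ x ∈ C, F₁ x ≠ 0 := by
    rintro x ⟨hF, hv, hbad⟩ h0
    have hD1 : fderiv ℝ F₁ x ≠ 0 := hreg₁ x h0
    have hD2 : fderiv ℝ wt x ≠ 0 := H2' x hF hv
    have hn1 : 0 < ‖fderiv ℝ F₁ x‖ := norm_pos_iff.2 hD1
    have hn2 : 0 < ‖fderiv ℝ wt x‖ := norm_pos_iff.2 hD2
    apply H3' x h0 hv (‖fderiv ℝ wt x‖ / ‖fderiv ℝ F₁ x‖) (div_pos hn2 hn1)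
    calc fderiv ℝ wt x = ‖fderiv ℝ F₁ x‖⁻¹ • (‖fderiv ℝ F₁ x‖ • fderiv ℝ wt x) := by
          rw [smul_smul, inv_mul_cancel₀ hn1.ne', one_smul]
      _ = ‖fderiv ℝ F₁ x‖⁻¹ • (‖fderiv ℝ wt x‖ • fderiv ℝ F₁ x) := by rw [hbad]
      _ = (‖fderiv ℝ wt x‖ / ‖fderiv ℝ F₁ x‖) • fderiv ℝ F₁ x := by
          rw [smul_smul, div_eq_inv_mul]
  -- a margin `η > 0` with `F₁ ≤ -η` on `C`
  obtain ⟨η, hη, hCη⟩ : ∃ η : ℝ, 0 < η ∧ ∀ x ∈ C, F₁ x ≤ -η := by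
    by_cases hne : C.Nonempty
    · obtain ⟨x₀, hx₀, hmax⟩ := hCc.exists_isMaxOn hne hF₁c.continuousOn
      have h0 : F₁ x₀ < 0 := lt_of_le_of_ne hx₀.1 (hC0 x₀ hx₀)
      refine ⟨-F₁ x₀, by linarith, fun x hx => ?_⟩
      have h := hmax hx
      rw [mem_setOf_eq] at h
      linarith
    · rw [not_nonempty_iff_eq_empty] at hne
      exact ⟨1, one_pos, fun x hx => by rw [hne] at hx; exact absurd hx (notMem_empty x)⟩
  -- H1 margin
  obtain ⟨δ₁, hδ₁, -, hH1⟩ :=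
    CappedBallLid.exists_pos_forall_fderiv_ne_zero (hF₁.of_le (by simp)) hε₁ hK₁ hreg₁
  -- the final `δ`
  set δ : ℝ := min δ₀ (min (η / 4) (δ₁ / 2)) with hδ_def
  have hδpos : 0 < δ := lt_min hδ₀ (lt_min (by linarith) (by linarith))
  have hδδ₀ : δ ≤ δ₀ := min_le_left _ _
  have hδη : δ ≤ η / 4 := le_trans (min_le_right _ _) (min_le_left _ _)
  have hδδ₁ : δ ≤ δ₁ / 2 := le_trans (min_le_right _ _) (min_le_right _ _)
  have H1 : ∀ x, -(2 * δ) ≤ F₁ x → F₁ x ≤ 0 → fderiv ℝ F₁ x ≠ 0 := by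
    intro x h1 h2
    apply hH1
    rw [abs_le]
    constructor <;> linarith
  have H2 : ∀ x, F₁ x ≤ 0 → wt x ≤ 1 + 2 * δ → fderiv ℝ wt x ≠ 0 :=
    fun x hF hv => H2' x hF (by linarith)
  have H3full : ∀ x, -(2 * δ) ≤ F₁ x → F₁ x ≤ 0 → wt x ≤ 1 + 3 * δ₀ → ∀ c : ℝ, 0 < c →
      fderiv ℝ wt x ≠ c • fderiv ℝ F₁ x := by
    intro x h1 h2 hv c hc heq
    have hxC : x ∈ C := by
      refine ⟨h2, hv, ?_⟩
      rw [heq, norm_smul, Real.norm_eq_abs, abs_of_pos hc, smul_smul, mul_comm]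
    have := hCη x hxC
    linarith
  have H3 : ∀ x, -(2 * δ) ≤ F₁ x → F₁ x ≤ 0 → wt x ≤ 1 + 2 * δ → ∀ c : ℝ, 0 < c →
      fderiv ℝ wt x ≠ c • fderiv ℝ F₁ x :=
    fun x h1 h2 hv c hc => H3full x h1 h2 (by linarith) c hc
  obtain ⟨Φ, hΦ1, hΦ2, hΦ3, -⟩ :=
    SmoothMax.exists_diffeomorph_image_sweep hP hP0 hP1 hPd hPge hPle hF₁ hwts hK₁ hε₁
      (fun x hx => hx) hδpos H1 H2 H3
  have hPdiff : Differentiable ℝ P := hP.differentiable (by simp)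
  -- regularity of the swept defining function on its zero set
  have hregU : ∀ x, F₁ x + δ * P ((1 - wt x - F₁ x) / δ) = 0 →
      fderiv ℝ (fun y => F₁ y + δ * P ((1 - wt y - F₁ y) / δ)) x ≠ 0 := by
    intro x hx0
    have hD := SmoothMax.hasFDerivAt_smax (P := P) hPdiff hδpos.ne'
      (hF₁.differentiable (by simp) x).hasFDerivAt
      ((hwts.differentiable (by simp) x).hasFDerivAt.const_sub 1)
    rw [hD.fderiv]
    set t : ℝ := (1 - wt x - F₁ x) / δ with ht_def
    have ht : 1 - wt x - F₁ x = δ * t := by rw [ht_def]; field_simp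
    rcases le_or_gt t (-1) with htl | htl
    · -- `θ = 0`, `F₁ x = 0`
      have hθ : deriv P t = 0 := SmoothMax.deriv_eq_zero_of_le hP0 hPge htl
      have hF0 : F₁ x = 0 := by rw [hP0 t htl, mul_zero, add_zero] at hx0; exact hx0
      rw [hθ, sub_zero, one_smul, zero_smul, add_zero]
      exact hreg₁ x hF0
    rcases le_or_gt 1 t with hth | hth
    · -- `θ = 1`, `wt x = 1`, `F₁ x ≤ 0`
      have hθ : deriv P t = 1 := SmoothMax.deriv_eq_one_of_le hPdiff hP1 hPge hth
      have hw1 : wt x = 1 := by rw [hP1 t hth] at hx0; linarith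
      have hF : F₁ x ≤ 0 := by
        have : δ ≤ δ * t := by nlinarith
        linarith
      rw [hθ, sub_self, zero_smul, zero_add, one_smul]
      intro h0
      exact H2 x hF (by linarith) (neg_eq_zero.1 h0)
    · -- the band `-1 < t < 1`
      obtain ⟨hθ0, hθ1⟩ := hPd t
      have hPt0 : max 0 t ≤ P t := hPge t
      have hPt1 : P t ≤ max 0 t + 1 := hPle t
      have hm0 : 0 ≤ max 0 t := le_max_left _ _
      have hm1 : max 0 t < 1 := max_lt one_pos hth
      have hF : F₁ x ≤ 0 := by nlinarith
      have hF2 : -(2 * δ) ≤ F₁ x := by nlinarith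
      have hv : wt x ≤ 1 + 3 * δ₀ := by nlinarith
      intro h0
      rcases hθ0.lt_or_eq with hθpos | hθz
      · -- `θ > 0`: `Dwt = ((1-θ)/θ) DF₁`
        have hsol : fderiv ℝ wt x = ((1 - deriv P t) / deriv P t) • fderiv ℝ F₁ x := by
          have h1 : deriv P t • fderiv ℝ wt x = (1 - deriv P t) • fderiv ℝ F₁ x := by
            rw [smul_neg, ← sub_eq_add_neg, sub_eq_zero] at h0
            exact h0.symm
          calc fderiv ℝ wt x = (deriv P t)⁻¹ • (deriv P t • fderiv ℝ wt x) := by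
                rw [smul_smul, inv_mul_cancel₀ hθpos.ne', one_smul]
            _ = ((1 - deriv P t) / deriv P t) • fderiv ℝ F₁ x := by
                rw [h1, smul_smul, div_eq_inv_mul]
        rcases hθ1.lt_or_eq with hθlt | hθone
        · exact H3full x hF2 hF hv _ (div_pos (by linarith) hθpos) hsol
        · apply H2' x hF hv
          rw [hsol, hθone, sub_self, zero_div, zero_smul]
      · -- `θ = 0`: `DF₁ = 0`
        rw [← hθz, sub_zero, one_smul, zero_smul, add_zero] at h0
        exact H1 x hF2 hF h0
  refine ⟨wt, T, δ, Φ, hwts, hTo, hBT, hGT, hwtT, hwtZ, hcon, hδpos, hδδ₀, hΦ1, hΦ2, hΦ3, hregU,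
    fun x hx => ?_, fun x hx => SmoothMax.smax_eq_left hP0 hδpos (by linarith),
    fun x hx => SmoothMax.smax_eq_right hP1 hδpos (by linarith)⟩
  have := SmoothMax.le_zero_of_smax_nonpos hPge hδpos hx
  exact ⟨this.1, by linarith [this.2]⟩

end Literature.Topology.FourManifolds.SweepTransfer
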